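import Mathlib
import HarnessLib
import HarnessLib.Audit
import Summits.ValiantsHypothesis.ValiantsHypothesis.Theorems.LacunarySymmetroidMatrixDescartesMiddleBinomial
import Summits.ValiantsHypothesis.ValiantsHypothesis.Theorems.LacunarySymmetroidMatrixDescartesZeroChangeFloorDictionary

/-!
# ValiantsHypothesis / LacunarySymmetroid — crux `MatrixDescartes` (stmt-ValiantsHypothesis-18050, V1), LINE (A) «product_plus_one»:
# BOTTOM BRACKETS — localisation of the critical points of a zero-free company between its extreme row bottoms, and the
# exact count for COMMON-BOTTOM companies (two-change «valley» rows `(+,−,+)` included)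

The stubs `stub_classRowK3 : ClassRowK3Linear` / `stub_eulerBoundK3 : EulerBoundK3` (`Cruxes/MatrixDescartes/Lines/product_plus_one.lean`)
ask for a count LINEAR in `m` of the positive critical points of `Φ = ∏_j g_j`, `g_j = a_{j0} + a_{j1}X^a + a_{j2}X^c` (`0 < a < c`;
Euler currency through ✓ `ZeroChange.card_posRoots_euler_bottom_eq_posCrit`).  Their RESIDUE after the landed sectors
(✓ `…ProductPlusOneLowerSigned`, header) contains the zero-free TWO-CHANGE rows `(+,−,+)` (VALLEY rows), which lie OUTSIDE the floor
`OneChangeFloorK3`.  This file isolates the mechanism governing them — the BOTTOM BRACKET `β_j(t) = a·a_{j1} + c·a_{j2}·t^{c−a}`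
(`t·g_j′(t) = t^a·β_j(t)`), strictly increasing when the top letter is positive — and proves, with NO ratio window, NO bound on `m`,
NO sign hypothesis on bottom / middle letters:
* `eval_derivative_row_{pos,neg,eq_zero}_iff` — the sign of `g_j′(t)` is the sign of `β_j(t)`; `bracket_lt_bracket`, `bottom_unique`;
  `eval_row_pos_of_bottom_pos` — a row positive AT ITS BOTTOM is zero-free on `(0,∞)`; `exists_commonBottom_of_ratio`;
* `eval_derivative_prod_rows_{pos,neg}` (+ `_of_brackets_{pos,neg}`, `_eq_zero_of_brackets_eq_zero`) — company pushes;
* ★ `le_of_mem_roots_derivative_of_brackets_{nonpos,nonneg}`, `mem_Icc_of_mem_roots_derivative` —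
  **LOCALISATION**: positive top letters, zero-free rows ⇒ every positive critical point of `Φ` lies between the leftmost and the
  rightmost ROW BOTTOM (brackets `≤ 0` at `τ₁`, `≥ 0` at `τ₂` ⇒ critical points in `[τ₁, τ₂]`);
* ★★ `posCrit_le_one_of_commonBottom` / `posCrit_eq_one_of_commonBottom` / `posCrit_eq_one_of_ratio` — **COMMON-BOTTOM LAW**: rows
  with the SAME bottom `τ`, positive there ⇒ EXACTLY ONE positive critical point, for every `m` (Descartes ceiling of the format:
  `C(m+2,2) − 1`);
* `euler_bottom_{le,eq}_one_of_commonBottom`, `euler_bottom_roots_mem_Icc` — the same in EULER CURRENCY (`Z₊(eulerNumerator d a 0)`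
  unfolded verbatim as in ✓ `card_posRoots_euler_bottom_eq_posCrit`), every support `d₀ < d₁ < d₂`.
So in the two-change residue the «interaction at a distance» is confined to the SPREAD of the row bottoms `[min_j τ_j, max_j τ_j]`
(`τ_j^{c−a} = −a·a_{j1}/(c·a_{j2})`) and vanishes with it; OPEN for the stubs in this sector: a count, linear in `m`, INSIDE the spread.

HONEST FRAMING: helper / sector theorems, def-free, no named facts, no `sorry`, standard axioms; closes NO stub by name;
`OneChangeFloorK3`, `EulerBoundK3`, `ClassRowK3Linear`, `PPOPolyLaw`, `MatrixDescartes` (stmt-ValiantsHypothesis-18050) stay OPEN;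
`VP ≠ VNP` is NOT proved and nothing here bears on it.
[folklore] Elementary calculus of trinomials and Rolle-type bookkeeping; no citation needed.
-/

set_option linter.dupNamespace false

namespace Summit.ValiantsHypothesis.ValiantsHypothesis.Theorems.LacunarySymmetroidMatrixDescartes

namespace ZeroChange

open Polynomial Finset

/-! ## §1 The bottom bracket of one row -/

/-- **`t·g′(t) = t^a·β(t)`** with the BOTTOM BRACKET `β(t) = a·a₁ + c·a₂·t^{c−a}` (`a ≤ c`, any letters, any `t`). [folklore] -/
theorem mul_eval_derivative_row_eq_bracket (a c : ℕ) (hac : a ≤ c) (a₀ a₁ a₂ t : ℝ) :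
    t * (derivative (row a c a₀ a₁ a₂)).eval t = t ^ a * ((a : ℝ) * a₁ + (c : ℝ) * a₂ * t ^ (c - a)) := by
  rw [mul_eval_derivative_row]
  rw [show t ^ c = t ^ a * t ^ (c - a) by rw [← pow_add, Nat.add_sub_cancel' hac]]
  ring

/-- At `t > 0` the derivative of a row is positive iff its bottom bracket is (any letters). [folklore] -/
theorem eval_derivative_row_pos_iff (a c : ℕ) (hac : a ≤ c) (a₀ a₁ a₂ : ℝ) {t : ℝ} (ht : 0 < t) :
    0 < (derivative (row a c a₀ a₁ a₂)).eval t ↔ 0 < (a : ℝ) * a₁ + (c : ℝ) * a₂ * t ^ (c - a) := by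
  rw [← mul_pos_iff_of_pos_left ht, mul_eval_derivative_row_eq_bracket a c hac, mul_pos_iff_of_pos_left (pow_pos ht a)]

/-- At `t > 0` the derivative of a row is negative iff its bottom bracket is (any letters). [folklore] -/
theorem eval_derivative_row_neg_iff (a c : ℕ) (hac : a ≤ c) (a₀ a₁ a₂ : ℝ) {t : ℝ} (ht : 0 < t) :
    (derivative (row a c a₀ a₁ a₂)).eval t < 0 ↔ (a : ℝ) * a₁ + (c : ℝ) * a₂ * t ^ (c - a) < 0 := by
  have h := mul_eval_derivative_row_eq_bracket a c hac a₀ a₁ a₂ t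
  have hta : 0 < t ^ a := pow_pos ht a
  constructor
  · intro hd
    by_contra hge
    have h1 : t * (derivative (row a c a₀ a₁ a₂)).eval t < 0 := mul_neg_of_pos_of_neg ht hd
    exact absurd (h ▸ h1) (not_lt.2 (mul_nonneg hta.le (not_lt.1 hge)))
  · intro hb
    by_contra hge
    have h1 : t ^ a * ((a : ℝ) * a₁ + (c : ℝ) * a₂ * t ^ (c - a)) < 0 := mul_neg_of_pos_of_neg hta hb
    exact absurd (h.symm ▸ h1) (not_lt.2 (mul_nonneg ht.le (not_lt.1 hge)))

/-- At `t > 0` a row is critical iff its bottom bracket vanishes (any letters). [folklore] -/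
theorem eval_derivative_row_eq_zero_iff (a c : ℕ) (hac : a ≤ c) (a₀ a₁ a₂ : ℝ) {t : ℝ} (ht : 0 < t) :
    (derivative (row a c a₀ a₁ a₂)).eval t = 0 ↔ (a : ℝ) * a₁ + (c : ℝ) * a₂ * t ^ (c - a) = 0 := by
  have h := mul_eval_derivative_row_eq_bracket a c hac a₀ a₁ a₂ t
  constructor
  · exact fun hd => (mul_eq_zero.1 (show t ^ a * ((a : ℝ) * a₁ + (c : ℝ) * a₂ * t ^ (c - a)) = 0 by
      rw [← h, hd, mul_zero])).resolve_left (pow_ne_zero _ ht.ne')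
  · exact fun hb => (mul_eq_zero.1 (show t * (derivative (row a c a₀ a₁ a₂)).eval t = 0 by
      rw [h, hb, mul_zero])).resolve_left ht.ne'

/-- The bottom bracket of a row with POSITIVE top letter is strictly increasing on `[0, ∞)` (`a < c`). [folklore] -/
theorem bracket_lt_bracket (a c : ℕ) (hac : a < c) (a₁ : ℝ) {a₂ : ℝ} (ha₂ : 0 < a₂) {t t' : ℝ} (ht : 0 ≤ t)
    (htt' : t < t') :
    (a : ℝ) * a₁ + (c : ℝ) * a₂ * t ^ (c - a) < (a : ℝ) * a₁ + (c : ℝ) * a₂ * t' ^ (c - a) := by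
  have hc : (0 : ℝ) < c := by exact_mod_cast (lt_of_le_of_lt (Nat.zero_le a) hac)
  linarith [mul_lt_mul_of_pos_left (pow_lt_pow_left₀ htt' ht (by omega : c - a ≠ 0)) (mul_pos hc ha₂)]

/-- The bottom of a row with positive top letter is UNIQUE: two zeros of the bracket in `(0,∞)` coincide. [folklore] -/
theorem bottom_unique (a c : ℕ) (hac : a < c) (a₁ : ℝ) {a₂ : ℝ} (ha₂ : 0 < a₂) {τ τ' : ℝ} (hτ : 0 < τ) (hτ' : 0 < τ')
    (h : (a : ℝ) * a₁ + (c : ℝ) * a₂ * τ ^ (c - a) = 0) (h' : (a : ℝ) * a₁ + (c : ℝ) * a₂ * τ' ^ (c - a) = 0) : τ = τ' := by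
  rcases lt_trichotomy τ τ' with hlt | heq | hgt
  · linarith [bracket_lt_bracket a c hac a₁ ha₂ hτ.le hlt]
  · exact heq
  · linarith [bracket_lt_bracket a c hac a₁ ha₂ hτ'.le hgt]

/-- **A row with positive top letter which is positive AT ITS BOTTOM is positive on all of `(0,∞)`** (the bottom is the global
minimum on `(0,∞)`: the row decreases before it and increases after it).  Turns the hypothesis «zero-free» of the localisation
theorems into one inequality per row. [folklore] -/
theorem eval_row_pos_of_bottom_pos (a c : ℕ) (hac : a < c) (a₀ a₁ : ℝ) {a₂ : ℝ} (ha₂ : 0 < a₂) {τ : ℝ} (hτ : 0 < τ)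
    (hb : (a : ℝ) * a₁ + (c : ℝ) * a₂ * τ ^ (c - a) = 0) (hval : 0 < (row a c a₀ a₁ a₂).eval τ) {t : ℝ} (ht : 0 < t) :
    0 < (row a c a₀ a₁ a₂).eval t := by
  set f : ℝ → ℝ := fun x => (row a c a₀ a₁ a₂).eval x with hf
  have hderiv : ∀ x, HasDerivAt f ((derivative (row a c a₀ a₁ a₂)).eval x) x := fun x => (row a c a₀ a₁ a₂).hasDerivAt x
  have hcont : Continuous f := (row a c a₀ a₁ a₂).continuous
  rcases lt_trichotomy t τ with hlt | heq | hgt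
  · have hanti : StrictAntiOn f (Set.Icc t τ) := by
      refine strictAntiOn_of_deriv_neg (convex_Icc t τ) hcont.continuousOn fun x hx => ?_
      rw [interior_Icc] at hx
      rw [(hderiv x).deriv]
      have hxpos : 0 < x := ht.trans hx.1
      refine (eval_derivative_row_neg_iff a c hac.le a₀ a₁ a₂ hxpos).2 ?_
      have := bracket_lt_bracket a c hac a₁ ha₂ hxpos.le hx.2
      linarith
    exact lt_trans hval (hanti (Set.left_mem_Icc.2 hlt.le) (Set.right_mem_Icc.2 hlt.le) hlt)
  · rw [heq]; exact hval
  · have hmono : StrictMonoOn f (Set.Icc τ t) := by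
      refine strictMonoOn_of_deriv_pos (convex_Icc τ t) hcont.continuousOn fun x hx => ?_
      rw [interior_Icc] at hx
      rw [(hderiv x).deriv]
      have hxpos : 0 < x := hτ.trans hx.1
      refine (eval_derivative_row_pos_iff a c hac.le a₀ a₁ a₂ hxpos).2 ?_
      have := bracket_lt_bracket a c hac a₁ ha₂ hτ.le hx.1
      linarith
    exact lt_trans hval (hmono (Set.left_mem_Icc.2 hgt.le) (Set.right_mem_Icc.2 hgt.le) hgt)

/-- Rows with a common NEGATIVE middle-to-top ratio `a₁ = −κ·a₂` (`κ > 0`, `0 < a < c`) have a COMMON BOTTOM `τ`,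
`τ^{c−a} = a·κ/c`. [folklore] -/
theorem exists_commonBottom_of_ratio (m a c : ℕ) (ha : 0 < a) (hac : a < c) (co : Fin m → ℝ × ℝ × ℝ) {κ : ℝ} (hκ : 0 < κ)
    (hratio : ∀ j, (co j).2.1 = -κ * (co j).2.2) :
    ∃ τ : ℝ, 0 < τ ∧ ∀ j, (a : ℝ) * (co j).2.1 + (c : ℝ) * (co j).2.2 * τ ^ (c - a) = 0 := by
  have hca : c - a ≠ 0 := by omega
  have ha' : (0 : ℝ) < a := by exact_mod_cast ha
  have hc : (0 : ℝ) < c := by exact_mod_cast (lt_trans ha hac)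
  set y : ℝ := (a : ℝ) * κ / c with hy
  have hypos : 0 < y := div_pos (mul_pos ha' hκ) hc
  refine ⟨y ^ ((c - a : ℕ) : ℝ)⁻¹, Real.rpow_pos_of_pos hypos _, fun j => ?_⟩
  rw [Real.rpow_inv_natCast_pow hypos.le hca, hratio j, hy]
  field_simp
  ring

/-! ## §2 The company: where all rows push the same way, `Φ′ ≠ 0` -/

/-- If every row is positive at `t`, all row derivatives are `≥ 0` there and one is `> 0`, then `Φ′(t) > 0`. [folklore] -/
theorem eval_derivative_prod_rows_pos (m a c : ℕ) (co : Fin m → ℝ × ℝ × ℝ) {t : ℝ}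
    (hpos : ∀ j, 0 < (row a c (co j).1 (co j).2.1 (co j).2.2).eval t)
    (hder : ∀ j, 0 ≤ (derivative (row a c (co j).1 (co j).2.1 (co j).2.2)).eval t)
    (hex : ∃ j, 0 < (derivative (row a c (co j).1 (co j).2.1 (co j).2.2)).eval t) :
    0 < (derivative (∏ j, row a c (co j).1 (co j).2.1 (co j).2.2)).eval t := by
  classical
  rw [eval_derivative_prod_rows m a c co (fun j => (hpos j).ne')]
  refine mul_pos ?_ ?_
  · rw [eval_prod]
    exact prod_pos fun j _ => hpos j
  · obtain ⟨j₀, hj₀⟩ := hex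
    have hle : (derivative (row a c (co j₀).1 (co j₀).2.1 (co j₀).2.2)).eval t /
        (row a c (co j₀).1 (co j₀).2.1 (co j₀).2.2).eval t ≤
        ∑ j, (derivative (row a c (co j).1 (co j).2.1 (co j).2.2)).eval t /
          (row a c (co j).1 (co j).2.1 (co j).2.2).eval t :=
      single_le_sum (f := fun j => (derivative (row a c (co j).1 (co j).2.1 (co j).2.2)).eval t /
        (row a c (co j).1 (co j).2.1 (co j).2.2).eval t) (fun j _ => div_nonneg (hder j) (hpos j).le) (mem_univ j₀)
    exact lt_of_lt_of_le (div_pos hj₀ (hpos j₀)) hle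

/-- If every row is positive at `t`, all row derivatives are `≤ 0` there and one is `< 0`, then `Φ′(t) < 0`. [folklore] -/
theorem eval_derivative_prod_rows_neg (m a c : ℕ) (co : Fin m → ℝ × ℝ × ℝ) {t : ℝ}
    (hpos : ∀ j, 0 < (row a c (co j).1 (co j).2.1 (co j).2.2).eval t)
    (hder : ∀ j, (derivative (row a c (co j).1 (co j).2.1 (co j).2.2)).eval t ≤ 0)
    (hex : ∃ j, (derivative (row a c (co j).1 (co j).2.1 (co j).2.2)).eval t < 0) :
    (derivative (∏ j, row a c (co j).1 (co j).2.1 (co j).2.2)).eval t < 0 := by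
  classical
  rw [eval_derivative_prod_rows m a c co (fun j => (hpos j).ne')]
  refine mul_neg_of_pos_of_neg ?_ ?_
  · rw [eval_prod]
    exact prod_pos fun j _ => hpos j
  · obtain ⟨j₀, hj₀⟩ := hex
    set f : Fin m → ℝ := fun j => (derivative (row a c (co j).1 (co j).2.1 (co j).2.2)).eval t /
      (row a c (co j).1 (co j).2.1 (co j).2.2).eval t with hf
    have hsplit : ∑ j, f j = f j₀ + ∑ j ∈ univ.erase j₀, f j := (add_sum_erase _ _ (mem_univ j₀)).symm
    have hrest : ∑ j ∈ univ.erase j₀, f j ≤ 0 :=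
      sum_nonpos fun j _ => div_nonpos_of_nonpos_of_nonneg (hder j) (hpos j).le
    have h0 : f j₀ < 0 := div_neg_of_neg_of_pos hj₀ (hpos j₀)
    show ∑ j, f j < 0
    linarith

/-- **RIGHT OF ALL BOTTOMS `Φ` INCREASES**: `m ≥ 1`, every row positive at `t > 0` and every bottom bracket positive at `t`
⇒ `Φ′(t) > 0` (any letters). [folklore] -/
theorem eval_derivative_prod_rows_pos_of_brackets_pos (m a c : ℕ) (hac : a ≤ c) (hm : 0 < m) (co : Fin m → ℝ × ℝ × ℝ)
    {t : ℝ} (ht : 0 < t) (hpos : ∀ j, 0 < (row a c (co j).1 (co j).2.1 (co j).2.2).eval t)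
    (hbr : ∀ j, 0 < (a : ℝ) * (co j).2.1 + (c : ℝ) * (co j).2.2 * t ^ (c - a)) :
    0 < (derivative (∏ j, row a c (co j).1 (co j).2.1 (co j).2.2)).eval t :=
  eval_derivative_prod_rows_pos m a c co hpos
    (fun j => ((eval_derivative_row_pos_iff a c hac _ _ _ ht).2 (hbr j)).le)
    ⟨⟨0, hm⟩, (eval_derivative_row_pos_iff a c hac _ _ _ ht).2 (hbr _)⟩

/-- **LEFT OF ALL BOTTOMS `Φ` DECREASES**: `m ≥ 1`, every row positive at `t > 0` and every bottom bracket negative at `t`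
⇒ `Φ′(t) < 0` (any letters). [folklore] -/
theorem eval_derivative_prod_rows_neg_of_brackets_neg (m a c : ℕ) (hac : a ≤ c) (hm : 0 < m) (co : Fin m → ℝ × ℝ × ℝ)
    {t : ℝ} (ht : 0 < t) (hpos : ∀ j, 0 < (row a c (co j).1 (co j).2.1 (co j).2.2).eval t)
    (hbr : ∀ j, (a : ℝ) * (co j).2.1 + (c : ℝ) * (co j).2.2 * t ^ (c - a) < 0) :
    (derivative (∏ j, row a c (co j).1 (co j).2.1 (co j).2.2)).eval t < 0 :=
  eval_derivative_prod_rows_neg m a c co hpos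
    (fun j => ((eval_derivative_row_neg_iff a c hac _ _ _ ht).2 (hbr j)).le)
    ⟨⟨0, hm⟩, (eval_derivative_row_neg_iff a c hac _ _ _ ht).2 (hbr _)⟩

/-- **AT A COMMON BOTTOM `Φ` IS CRITICAL**: if every bottom bracket vanishes at `t > 0` then `Φ′(t) = 0` (any letters, rows may
vanish at `t` or not). [folklore] -/
theorem eval_derivative_prod_rows_eq_zero_of_brackets_eq_zero (m a c : ℕ) (hac : a ≤ c) (co : Fin m → ℝ × ℝ × ℝ)
    {t : ℝ} (ht : 0 < t) (hbr : ∀ j, (a : ℝ) * (co j).2.1 + (c : ℝ) * (co j).2.2 * t ^ (c - a) = 0) :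
    (derivative (∏ j, row a c (co j).1 (co j).2.1 (co j).2.2)).eval t = 0 := by
  classical
  rw [derivative_prod_finset, eval_finsetSum]
  refine sum_eq_zero fun j _ => ?_
  rw [eval_mul, (eval_derivative_row_eq_zero_iff a c hac _ _ _ ht).2 (hbr j), mul_zero]

/-! ## §3 Localisation of the critical points of a zero-free company between its extreme bottoms -/

/-- A company whose product has a nonzero derivative is nonempty. [folklore] -/
theorem pos_of_derivative_prod_rows_ne_zero (m a c : ℕ) (co : Fin m → ℝ × ℝ × ℝ)
    (hne : derivative (∏ j, row a c (co j).1 (co j).2.1 (co j).2.2) ≠ 0) : 0 < m := by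
  rcases Nat.eq_zero_or_pos m with rfl | hm
  · exact absurd (by simp) hne
  · exact hm

/-- ★ **NO CRITICAL POINT LEFT OF THE LEFTMOST BOTTOM**: positive top letters, rows zero-free on `(0,∞)`, all bottom brackets
`≤ 0` at `τ₁ > 0` (every row bottom is `≥ τ₁`) ⇒ every positive root of `Φ′` is `≥ τ₁`. [folklore] -/
theorem le_of_mem_roots_derivative_of_brackets_nonpos (m a c : ℕ) (hac : a < c) (co : Fin m → ℝ × ℝ × ℝ)
    (htop : ∀ j, 0 < (co j).2.2)
    (hpos : ∀ j, ∀ t : ℝ, 0 < t → 0 < (row a c (co j).1 (co j).2.1 (co j).2.2).eval t)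
    {τ₁ : ℝ} (h₁ : ∀ j, (a : ℝ) * (co j).2.1 + (c : ℝ) * (co j).2.2 * τ₁ ^ (c - a) ≤ 0)
    {t : ℝ} (ht : 0 < t) (hroot : t ∈ (derivative (∏ j, row a c (co j).1 (co j).2.1 (co j).2.2)).roots) :
    τ₁ ≤ t := by
  classical
  have hne : derivative (∏ j, row a c (co j).1 (co j).2.1 (co j).2.2) ≠ 0 := (mem_roots'.1 hroot).1
  have hΦ' : (derivative (∏ j, row a c (co j).1 (co j).2.1 (co j).2.2)).eval t = 0 := (mem_roots'.1 hroot).2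
  have hm : 0 < m := pos_of_derivative_prod_rows_ne_zero m a c co hne
  by_contra hlt
  push Not at hlt
  have hbr : ∀ j, (a : ℝ) * (co j).2.1 + (c : ℝ) * (co j).2.2 * t ^ (c - a) < 0 := fun j =>
    lt_of_lt_of_le (bracket_lt_bracket a c hac _ (htop j) ht.le hlt) (h₁ j)
  have := eval_derivative_prod_rows_neg_of_brackets_neg m a c hac.le hm co ht (fun j => hpos j t ht) hbr
  exact this.ne hΦ'

/-- ★ **NO CRITICAL POINT RIGHT OF THE RIGHTMOST BOTTOM**: positive top letters, rows zero-free on `(0,∞)`, all bottom brackets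
`≥ 0` at `τ₂ > 0` (every row bottom is `≤ τ₂`; automatic for coherent rows) ⇒ every positive root of `Φ′` is `≤ τ₂`. [folklore] -/
theorem le_of_mem_roots_derivative_of_brackets_nonneg (m a c : ℕ) (hac : a < c) (co : Fin m → ℝ × ℝ × ℝ)
    (htop : ∀ j, 0 < (co j).2.2)
    (hpos : ∀ j, ∀ t : ℝ, 0 < t → 0 < (row a c (co j).1 (co j).2.1 (co j).2.2).eval t)
    {τ₂ : ℝ} (hτ₂ : 0 < τ₂) (h₂ : ∀ j, 0 ≤ (a : ℝ) * (co j).2.1 + (c : ℝ) * (co j).2.2 * τ₂ ^ (c - a))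
    {t : ℝ} (ht : 0 < t) (hroot : t ∈ (derivative (∏ j, row a c (co j).1 (co j).2.1 (co j).2.2)).roots) :
    t ≤ τ₂ := by
  classical
  have hne : derivative (∏ j, row a c (co j).1 (co j).2.1 (co j).2.2) ≠ 0 := (mem_roots'.1 hroot).1
  have hΦ' : (derivative (∏ j, row a c (co j).1 (co j).2.1 (co j).2.2)).eval t = 0 := (mem_roots'.1 hroot).2
  have hm : 0 < m := pos_of_derivative_prod_rows_ne_zero m a c co hne
  by_contra hlt
  push Not at hlt
  have hbr : ∀ j, 0 < (a : ℝ) * (co j).2.1 + (c : ℝ) * (co j).2.2 * t ^ (c - a) := fun j =>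
    lt_of_le_of_lt (h₂ j) (bracket_lt_bracket a c hac _ (htop j) hτ₂.le hlt)
  have := eval_derivative_prod_rows_pos_of_brackets_pos m a c hac.le hm co ht (fun j => hpos j t ht) hbr
  exact this.ne' hΦ'

/-- ★★ **LOCALISATION BETWEEN THE EXTREME BOTTOMS**: positive top letters, zero-free rows; brackets `≤ 0` at `τ₁` and `≥ 0`
at `τ₂` ⇒ every positive critical point of `Φ` lies in `[τ₁, τ₂]`. [folklore] -/
theorem mem_Icc_of_mem_roots_derivative (m a c : ℕ) (hac : a < c) (co : Fin m → ℝ × ℝ × ℝ)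
    (htop : ∀ j, 0 < (co j).2.2)
    (hpos : ∀ j, ∀ t : ℝ, 0 < t → 0 < (row a c (co j).1 (co j).2.1 (co j).2.2).eval t)
    {τ₁ τ₂ : ℝ} (hτ₂ : 0 < τ₂)
    (h₁ : ∀ j, (a : ℝ) * (co j).2.1 + (c : ℝ) * (co j).2.2 * τ₁ ^ (c - a) ≤ 0)
    (h₂ : ∀ j, 0 ≤ (a : ℝ) * (co j).2.1 + (c : ℝ) * (co j).2.2 * τ₂ ^ (c - a))
    {t : ℝ} (ht : 0 < t) (hroot : t ∈ (derivative (∏ j, row a c (co j).1 (co j).2.1 (co j).2.2)).roots) :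
    t ∈ Set.Icc τ₁ τ₂ :=
  ⟨le_of_mem_roots_derivative_of_brackets_nonpos m a c hac co htop hpos h₁ ht hroot,
    le_of_mem_roots_derivative_of_brackets_nonneg m a c hac co htop hpos hτ₂ h₂ ht hroot⟩

/-! ## §4 The common-bottom law: exactly one critical point, every `m` -/

/-- ★★ **COMMON-BOTTOM LAW (upper bound)**: positive top letters, a common bottom `τ > 0` (`β_j(τ) = 0` for all `j`), every row
positive at `τ` ⇒ `Φ` has AT MOST ONE positive critical point — for every `m`. [folklore] -/
theorem posCrit_le_one_of_commonBottom (m a c : ℕ) (hac : a < c) (co : Fin m → ℝ × ℝ × ℝ)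
    (htop : ∀ j, 0 < (co j).2.2) {τ : ℝ} (hτ : 0 < τ)
    (hb : ∀ j, (a : ℝ) * (co j).2.1 + (c : ℝ) * (co j).2.2 * τ ^ (c - a) = 0)
    (hval : ∀ j, 0 < (row a c (co j).1 (co j).2.1 (co j).2.2).eval τ) :
    posCrit (∏ j, row a c (co j).1 (co j).2.1 (co j).2.2) ≤ 1 := by
  classical
  have hpos : ∀ j, ∀ t : ℝ, 0 < t → 0 < (row a c (co j).1 (co j).2.1 (co j).2.2).eval t :=
    fun j t ht => eval_row_pos_of_bottom_pos a c hac _ _ (htop j) hτ (hb j) (hval j) ht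
  rw [posCrit]
  refine card_le_one.2 fun x hx y hy => ?_
  simp only [mem_filter, Multiset.mem_toFinset] at hx hy
  have hx' := mem_Icc_of_mem_roots_derivative m a c hac co htop hpos hτ (fun j => (hb j).le) (fun j => (hb j).ge) hx.2 hx.1
  have hy' := mem_Icc_of_mem_roots_derivative m a c hac co htop hpos hτ (fun j => (hb j).le) (fun j => (hb j).ge) hy.2 hy.1
  exact le_antisymm (hx'.2.trans hy'.1) (hy'.2.trans hx'.1)

/-- ★★ **COMMON-BOTTOM LAW (exact)**: under the same hypotheses with `m ≥ 1`, `Φ` has EXACTLY ONE positive critical point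
(the common bottom `τ`). [folklore] -/
theorem posCrit_eq_one_of_commonBottom (m a c : ℕ) (hac : a < c) (hm : 0 < m) (co : Fin m → ℝ × ℝ × ℝ)
    (htop : ∀ j, 0 < (co j).2.2) {τ : ℝ} (hτ : 0 < τ)
    (hb : ∀ j, (a : ℝ) * (co j).2.1 + (c : ℝ) * (co j).2.2 * τ ^ (c - a) = 0)
    (hval : ∀ j, 0 < (row a c (co j).1 (co j).2.1 (co j).2.2).eval τ) :
    posCrit (∏ j, row a c (co j).1 (co j).2.1 (co j).2.2) = 1 := by
  classical
  refine le_antisymm (posCrit_le_one_of_commonBottom m a c hac co htop hτ hb hval) ?_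
  have hpos : ∀ j, ∀ t : ℝ, 0 < t → 0 < (row a c (co j).1 (co j).2.1 (co j).2.2).eval t :=
    fun j t ht => eval_row_pos_of_bottom_pos a c hac _ _ (htop j) hτ (hb j) (hval j) ht
  have hτ1 : 0 < τ + 1 := by linarith
  have hne : derivative (∏ j, row a c (co j).1 (co j).2.1 (co j).2.2) ≠ 0 := by
    intro h0
    have h1 := eval_derivative_prod_rows_pos_of_brackets_pos m a c hac.le hm co hτ1 (fun j => hpos j _ hτ1)
      (fun j => by
        have := bracket_lt_bracket a c hac (co j).2.1 (htop j) hτ.le (show τ < τ + 1 by linarith)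
        linarith [hb j])
    exact lt_irrefl _ (by rwa [h0, eval_zero] at h1)
  rw [posCrit]
  refine one_le_card.2 ⟨τ, ?_⟩
  simp only [mem_filter, Multiset.mem_toFinset]
  exact ⟨(mem_roots hne).2 (eval_derivative_prod_rows_eq_zero_of_brackets_eq_zero m a c hac.le co hτ hb), hτ⟩

/-- **Common-ratio form**: rows `(a_{j0}, −κ·a_{j2}, a_{j2})` with `a_{j2} > 0`, one `κ > 0` for the whole company, each positive at
the common bottom, have exactly one positive critical point (`m ≥ 1`, `0 < a < c`). [folklore] -/
theorem posCrit_eq_one_of_ratio (m a c : ℕ) (ha : 0 < a) (hac : a < c) (hm : 0 < m) (co : Fin m → ℝ × ℝ × ℝ)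
    (htop : ∀ j, 0 < (co j).2.2) {κ : ℝ} (hκ : 0 < κ) (hratio : ∀ j, (co j).2.1 = -κ * (co j).2.2)
    (hval : ∀ τ : ℝ, 0 < τ → (∀ j, (a : ℝ) * (co j).2.1 + (c : ℝ) * (co j).2.2 * τ ^ (c - a) = 0) →
      ∀ j, 0 < (row a c (co j).1 (co j).2.1 (co j).2.2).eval τ) :
    posCrit (∏ j, row a c (co j).1 (co j).2.1 (co j).2.2) = 1 := by
  obtain ⟨τ, hτ, hb⟩ := exists_commonBottom_of_ratio m a c ha hac co hκ hratio
  exact posCrit_eq_one_of_commonBottom m a c hac hm co htop hτ hb (hval τ hτ hb)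

/-! ## §5 Euler currency (the line's `eulerNumerator d a 0`, unfolded; every support `d₀ < d₁ < d₂`) -/

/-- ★ **COMMON-BOTTOM LAW IN EULER CURRENCY**: on a support `d₀ < d₁ < d₂`, a company `a : Fin m → Fin 3 → ℝ` with positive top
letters whose bottom brackets `(d₁−d₀)·a_{j1} + (d₂−d₀)·a_{j2}·τ^{d₂−d₁}` all vanish at one `τ > 0`, every row positive at `τ`,
has `Z₊(eulerNumerator d a 0) ≤ 1` — for every `m` (exactly `1` if `m ≥ 1`, next theorem). [folklore] -/
theorem euler_bottom_le_one_of_commonBottom {m : ℕ} (d : Fin 3 → ℕ) (h01 : d 0 < d 1) (h12 : d 1 < d 2)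
    (a : Fin m → Fin 3 → ℝ) (htop : ∀ j, 0 < a j 2) {τ : ℝ} (hτ : 0 < τ)
    (hb : ∀ j, ((d 1 - d 0 : ℕ) : ℝ) * a j 1 + ((d 2 - d 0 : ℕ) : ℝ) * a j 2 * τ ^ (d 2 - d 1) = 0)
    (hval : ∀ j, 0 < (row (d 1 - d 0) (d 2 - d 0) (a j 0) (a j 1) (a j 2)).eval τ) :
    ((∑ j, (∑ l, C (a j l * ((d l : ℝ) - d 0)) * X ^ (d l)) * ∏ i ∈ Finset.univ.erase j, (∑ l, C (a i l) * X ^ (d l))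
        : ℝ[X]).roots.toFinset.filter (fun t => 0 < t)).card ≤ 1 := by
  rw [card_posRoots_euler_bottom_eq_posCrit d h01.le (h01.le.trans h12.le) a]
  have he : d 2 - d 0 - (d 1 - d 0) = d 2 - d 1 := by omega
  refine posCrit_le_one_of_commonBottom m (d 1 - d 0) (d 2 - d 0) (by omega) (fun j => (a j 0, a j 1, a j 2)) htop hτ
    (fun j => ?_) hval
  rw [he]
  exact hb j

/-- ★ **COMMON-BOTTOM LAW IN EULER CURRENCY (exact)**: as above with `m ≥ 1`: `Z₊(eulerNumerator d a 0) = 1`. [folklore] -/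
theorem euler_bottom_eq_one_of_commonBottom {m : ℕ} (hm : 0 < m) (d : Fin 3 → ℕ) (h01 : d 0 < d 1) (h12 : d 1 < d 2)
    (a : Fin m → Fin 3 → ℝ) (htop : ∀ j, 0 < a j 2) {τ : ℝ} (hτ : 0 < τ)
    (hb : ∀ j, ((d 1 - d 0 : ℕ) : ℝ) * a j 1 + ((d 2 - d 0 : ℕ) : ℝ) * a j 2 * τ ^ (d 2 - d 1) = 0)
    (hval : ∀ j, 0 < (row (d 1 - d 0) (d 2 - d 0) (a j 0) (a j 1) (a j 2)).eval τ) :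
    ((∑ j, (∑ l, C (a j l * ((d l : ℝ) - d 0)) * X ^ (d l)) * ∏ i ∈ Finset.univ.erase j, (∑ l, C (a i l) * X ^ (d l))
        : ℝ[X]).roots.toFinset.filter (fun t => 0 < t)).card = 1 := by
  rw [card_posRoots_euler_bottom_eq_posCrit d h01.le (h01.le.trans h12.le) a]
  have he : d 2 - d 0 - (d 1 - d 0) = d 2 - d 1 := by omega
  refine posCrit_eq_one_of_commonBottom m (d 1 - d 0) (d 2 - d 0) (by omega) hm (fun j => (a j 0, a j 1, a j 2)) htop hτ
    (fun j => ?_) hval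
  rw [he]
  exact hb j

/-- ★ **LOCALISATION IN EULER CURRENCY**: on a support `d₀ < d₁ < d₂`, a company with positive top letters whose rows are zero-free
on `(0,∞)`: if all bottom brackets are `≤ 0` at `τ₁ > 0` and `≥ 0` at `τ₂ > 0`, every positive root of `eulerNumerator d a 0` (an element of
the finset the line counts) lies in `[τ₁, τ₂]`. [folklore] -/
theorem euler_bottom_roots_mem_Icc {m : ℕ} (d : Fin 3 → ℕ) (h01 : d 0 < d 1) (h12 : d 1 < d 2)
    (a : Fin m → Fin 3 → ℝ) (htop : ∀ j, 0 < a j 2)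
    (hpos : ∀ j, ∀ t : ℝ, 0 < t → 0 < (row (d 1 - d 0) (d 2 - d 0) (a j 0) (a j 1) (a j 2)).eval t)
    {τ₁ τ₂ : ℝ} (hτ₂ : 0 < τ₂)
    (h₁ : ∀ j, ((d 1 - d 0 : ℕ) : ℝ) * a j 1 + ((d 2 - d 0 : ℕ) : ℝ) * a j 2 * τ₁ ^ (d 2 - d 1) ≤ 0)
    (h₂ : ∀ j, 0 ≤ ((d 1 - d 0 : ℕ) : ℝ) * a j 1 + ((d 2 - d 0 : ℕ) : ℝ) * a j 2 * τ₂ ^ (d 2 - d 1))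
    :
    ∀ t ∈ ((∑ j, (∑ l, C (a j l * ((d l : ℝ) - d 0)) * X ^ (d l)) * ∏ i ∈ Finset.univ.erase j, (∑ l, C (a i l) * X ^ (d l))
        : ℝ[X]).roots.toFinset.filter (fun t => 0 < t)), τ₁ ≤ t ∧ t ≤ τ₂ := by
  classical
  intro t hroot
  rw [euler_bottom_eq_X_pow_mul_derivative d h01.le (h01.le.trans h12.le) a] at hroot
  simp only [mem_filter, Multiset.mem_toFinset] at hroot
  obtain ⟨hroot, ht⟩ := hroot
  have hne := (mem_roots'.1 hroot).1
  rw [roots_mul hne, Multiset.mem_add] at hroot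
  have hroot' : t ∈ (derivative (∏ j, row (d 1 - d 0) (d 2 - d 0) (a j 0) (a j 1) (a j 2))).roots := by
    rcases hroot with h | h
    · exfalso
      rw [roots_pow, roots_X] at h
      have : t = 0 := by
        have := Multiset.mem_nsmul.1 h
        simpa using this
      exact ht.ne' this
    · exact h
  have he : d 2 - d 0 - (d 1 - d 0) = d 2 - d 1 := by omega
  have key := mem_Icc_of_mem_roots_derivative m (d 1 - d 0) (d 2 - d 0) (by omega) (fun j => (a j 0, a j 1, a j 2)) htop hpos
    hτ₂ (fun j => by rw [he]; exact h₁ j) (fun j => by rw [he]; exact h₂ j) ht hroot'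
  exact key

end ZeroChange

end Summit.ValiantsHypothesis.ValiantsHypothesis.Theorems.LacunarySymmetroidMatrixDescartes
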